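import Summits.AtomisticToContinuum.HydrodynamicLimit.Theorems.AprioriBounds.Negative.EquilibriumRung
import Summits.AtomisticToContinuum.HydrodynamicLimit.Theorems.CollisionIsometryCLTAprioriBoundsVisitLedgerDefs
import Literature.MathematicalPhysics.KineticTheory.HardSphereEulerProofs
import HarnessLib

/-!
# Vocabulary of the line `fibre-deficit-transfer` for the crux `AprioriBounds`
(stmt-AtomisticToContinuum-14827; `StiffCollisionalRelaxation.AprioriBounds` rank 4 =
`CollisionIsometryCLT.AprioriBoundsPreShock` rank 5, one `Prop` by `AprioriBoundsNegative.aprioriBoundsPreShock_iff`)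

Definitions-only support file (`--supports stmt-AtomisticToContinuum-14827`) of the lead prover of the line
(`Cruxes/AprioriBounds/Lines/fibre_deficit_transfer.lean`, planner
`planner-cruxplan-stmt-AtomisticToContinuum-14827-fibre-deficit-transf-0`; lead reshape r2 by
`prover-line-stmt-AtomisticToContinuum-14827-a1-0`).  It makes the line's vocabulary IMPORTABLE so that each
registered stub lands in its own sorry-free Theorems file with the registered signature verbatim.  Nothing is
asserted: every `def … : Prop` below is a predicate WITH PARAMETERS that a stub proves or consumes, never a
hypothesis taken as a fact.  Types `Cfg`, `Flow`, `Flows` and the profile hypothesis `NiceProfiles` are REUSED from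
`Theorems.VisitLedgerUpscattering` (landed Defs of the sibling line); components (i)/(ii) of the crux are
`AprioriBoundsNegative.PartOneAt` / `PartTwoAt` (landed).

## The line in one identity

Fix `s ≤ t < T`.  Let `μ_s` be the law of the gas at time `s` (the local Gibbs law `μ₀` pushed by the flow) and
`G_s` the LOCAL GIBBS STATE TILTED BY THE ENTROPY-GRADIENT FIELD `Λ(s,·) = Dη_σ(U_cl(s,·))` of the classical Euler
solution — the measure with density `exp(Φ_s)/Z_N(Λ_s)` against Liouville, `Φ_s(w) = ∑ᵢ Λ(s,xᵢ)·(1, vᵢ, |vᵢ|²/2)`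
(`tiltPot`, `tiltZ`).  Liouville invariance of the flow gives `∫ f_s log f_s = ∫ f₀ log f₀ = −S(μ₀)`, hence

  `H(μ_s | G_s) = [log Z_N(Λ_s) − S(μ₀) − (N+1)·m_s] − (N+1)·E_{μ_s}[ℓ_s]`,

`m_s = ∫Λ_s·U_cl(s)` (`tiltMean`), `ℓ_s = (N+1)⁻¹Φ_s − m_s` (`linStat`, the pointwise Λ-tested linear statistic).
The bracket is statics + exact isentropy of the classical solution (`TiltedExcessAt`); one rated linear statistic
(`LinearHydroRateAt`) then makes `H(μ_s | G_s)` sub-extensive, and the entropy inequality transfers the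
conditional-Gaussian Chernoff bound of `G_s` for one-particle tail fractions (`frac`) to `μ_s` (`BulkTailAt`);
with a far-tail occupation input (`FarTailAt`) the λ-dial gives component (i).

## Design choice of reshape r2: the tilt is typed by its explicit formula

For `U = (ρ, ρu, ρ(|u|²/2 + 3θ/2))` and `η_σ(U) = −ρ[(3/2)log θ − log ρ − f_ex(ρσ³)]` one computes
`Dη_σ(U) = (λ₀, u/θ, −1/θ)` with `λ₀ = log ρ − (3/2)log θ − |u|²/(2θ) + 5/2 + f_ex(ρσ³) + ρσ³f_ex'(ρσ³)` (`lam0`), so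
`Λ·(1, v, |v|²/2) = λ₀ + ⟪u, v⟫/θ − |v|²/(2θ)` (`tiltExponent`) and `Λ·U = ρ(λ₀ + |u|²/(2θ) − 3/2)` (`tiltMean`).  The
planner's skeleton typed `Λ` as `fderiv ℝ (etaσ σ) (U_cl)`; the explicit formula agrees with it wherever `η_σ` is
differentiable and is junk-free otherwise (a non-differentiable `f_ex` would make the `fderiv` vanish, `Z = ∞` and
every stub vacuous), it uses `deriv hsExcessFreeEnergy` exactly as the tree's `hsCompressibility` does, and it makes
the conditional Gaussian law of `G_s` (velocities independent `N(u(s,xᵢ), θ(s,xᵢ))` given positions) manifest.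
-/

noncomputable section

open MeasureTheory Filter Set Topology
open scoped ENNReal

namespace Summit.AtomisticToContinuum.HydrodynamicLimit.Theorems.FibreDeficitTransfer

open Literature.MathematicalPhysics.KineticTheory Literature.Analysis.FluidPDE
open Summit.AtomisticToContinuum.HydrodynamicLimit.Theorems.VisitLedgerUpscattering (Cfg Flow Flows NiceProfiles)

/-! ## Measures and densities -/

/-- The Liouville measure of `N + 1` spheres of reduced diameter `σ` on `𝕋³` (Lebesgue restricted to the hard-core
domain; not normalised; infinite, the velocities range over `ℝ³`). -/
abbrev liou (σ : ℝ) (N : ℕ) : Measure (Cfg N) :=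
  liouville (Torus.geometry (Fin 3)) (N + 1) (hsDiameter σ N)

/-- The local Gibbs density `f₀ = dμ₀/dLiouville` of `N + 1` spheres with profiles `(a₀, u₀, θ₀)` (real-valued;
`localGibbsLaw … = volume.withDensity (ofReal ∘ f₀)`, `localGibbsLaw_eq`; `f₀` vanishes off the hard-core domain). -/
abbrev dens (σ : ℝ) (a₀ : T3 → ℝ) (u₀ : T3 → V3) (θ₀ : T3 → ℝ) (N : ℕ) : Cfg N → ℝ :=
  canonicalDensity (Torus.geometry (Fin 3)) (hsDiameter σ N) (N + 1) (localGibbsProfile a₀ u₀ θ₀)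

/-- The GIBBS ENTROPY `S(μ₀) = −∫ f₀ log f₀ dLiouville` of the local Gibbs law of `N + 1` spheres (Bochner integral;
the integrand is integrable for continuous positive profiles — Gaussian velocities, bounded activity). -/
def gibbsEntropy (σ : ℝ) (a₀ : T3 → ℝ) (u₀ : T3 → V3) (θ₀ : T3 → ℝ) (N : ℕ) : ℝ :=
  -∫ w, dens σ a₀ u₀ θ₀ N w * Real.log (dens σ a₀ u₀ θ₀ N w) ∂(liou σ N)

/-! ## The entropy-gradient tilt of a macroscopic state `(ρ, u, θ)` -/

/-- The DENSITY MULTIPLIER `λ₀ = ∂η_σ/∂ρ` at the state `(ρ, u, θ)`: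
`log ρ − (3/2) log θ − |u|²/(2θ) + 5/2 + f_ex(ρσ³) + ρσ³ f_ex'(ρσ³)` (`f_ex = hsExcessFreeEnergy`, `f_ex'` its `deriv`,
the convention of `hsCompressibility`). -/
def lam0 (σ ρ θ : ℝ) (u : V3) : ℝ :=
  Real.log ρ - 3 / 2 * Real.log θ - ‖u‖ ^ 2 / (2 * θ) + 5 / 2 + hsExcessFreeEnergy (ρ * σ ^ 3) +
    ρ * σ ^ 3 * deriv hsExcessFreeEnergy (ρ * σ ^ 3)

/-- The ONE-PARTICLE TILT EXPONENT `Λ(s, x)·(1, v, |v|²/2) = λ₀(s,x) + ⟪u(s,x), v⟫/θ(s,x) − |v|²/(2θ(s,x))` of the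
fields `(ρ, u, θ)` at time `s`, evaluated at a one-particle state `y = (x, v)`.  Given `x` it is, up to the
`v`-free term `λ₀ + |u|²/(2θ)`, the log-density `−|v − u|²/(2θ)` of the Gaussian `N(u(s,x), θ(s,x))`. -/
def tiltExponent (σ : ℝ) (ρ θ : ℝ → T3 → ℝ) (u : ℝ → T3 → V3) (s : ℝ) (y : T3 × V3) : ℝ :=
  lam0 σ (ρ s y.1) (θ s y.1) (u s y.1) + inner ℝ (u s y.1) y.2 / θ s y.1 - ‖y.2‖ ^ 2 / (2 * θ s y.1)

/-- The EULER MEAN of the tilt, `m_s = ∫ Λ(s,x)·U(s,x) dx = ∫ ρ (λ₀ + |u|²/(2θ) − 3/2) dx`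
(`U = (ρ, ρu, ρ(|u|²/2 + 3θ/2))`; Bochner integral over `𝕋³`). -/
def tiltMean (σ : ℝ) (ρ θ : ℝ → T3 → ℝ) (u : ℝ → T3 → V3) (s : ℝ) : ℝ :=
  ∫ x, ρ s x * (lam0 σ (ρ s x) (θ s x) (u s x) + ‖u s x‖ ^ 2 / (2 * θ s x) - 3 / 2)

/-- THE LINEAR STATISTIC `ℓ_s(w) = (N+1)⁻¹ ∑ᵢ Λ(s, xᵢ)·(1, vᵢ, |vᵢ|²/2) − m_s` of a configuration `w` (pointwise,
kernel-free: the empirical measure tested against the five fields of `Λ(s,·)`, centred at the Euler mean). -/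
def linStat (σ : ℝ) (ρ θ : ℝ → T3 → ℝ) (u : ℝ → T3 → V3) {N : ℕ} (s : ℝ) (w : Cfg N) : ℝ :=
  (∫ y, tiltExponent σ ρ θ u s y ∂(empiricalMeasure w)) - tiltMean σ ρ θ u s

/-- The TILT POTENTIAL `Φ_s(w) = ∑ᵢ Λ(s, xᵢ)·(1, vᵢ, |vᵢ|²/2) = (N+1)(ℓ_s(w) + m_s)`. -/
def tiltPot (σ : ℝ) (ρ θ : ℝ → T3 → ℝ) (u : ℝ → T3 → V3) {N : ℕ} (s : ℝ) (w : Cfg N) : ℝ :=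
  ∑ i, tiltExponent σ ρ θ u s (w i)

/-- The TILTED PARTITION FUNCTION `Z_N(Λ_s) = ∫ exp Φ_s dLiouville` (an `ℝ≥0∞`).  `exp Φ_s / Z_N(Λ_s)` is the density
of the LOCAL GIBBS STATE `G_s` fitted to the fields at time `s`: given the positions its velocities are independent
Gaussians `N(u(s,xᵢ), θ(s,xᵢ)·𝟙)`. -/
def tiltZ (σ : ℝ) (ρ θ : ℝ → T3 → ℝ) (u : ℝ → T3 → V3) (N : ℕ) (s : ℝ) : ℝ≥0∞ :=
  ∫⁻ w, ENNReal.ofReal (Real.exp (tiltPot σ ρ θ u s w)) ∂(liou σ N)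

/-- The one-particle TAIL FRACTION above level `K`: `frac_K(w) = (N+1)⁻¹ #{i | K ≤ |vᵢ|²}` (the empirical measure of
the super-level set; a number in `[0, 1]`, equal to `1` for `K ≤ 0`). -/
def frac {N : ℕ} (K : ℝ) (w : Cfg N) : ℝ :=
  (empiricalMeasure w {y | K ≤ ‖y.2‖ ^ 2}).toReal

/-! ## The packages of the line (predicates at fixed `σ`, profiles, fields, flow family, horizon) -/

/-- `LinearHydroRateAt` — THE ONE RATED DYNAMICAL INPUT: eventually in `N`, at every fixed `s ≤ t`, the linear
statistic exceeds `(N+1)^{-b}` in absolute value with probability `≤ (N+1)^{-p}`, for SOME `b, p > 0` (triage r1-2's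
retype `LinearHydroRate' (b p)`: pointwise statistic, decoupled existential exponents). -/
def LinearHydroRateAt (σ : ℝ) (a₀ θ₀ : T3 → ℝ) (u₀ : T3 → V3) (ρ θ : ℝ → T3 → ℝ) (u : ℝ → T3 → V3)
    (Φ : Flows σ) (t : ℝ) : Prop :=
  ∃ b p : ℝ, 0 < b ∧ 0 < p ∧ ∃ N₀ : ℕ, ∀ N : ℕ, N₀ ≤ N → ∀ s ∈ Icc 0 t,
    localGibbsLaw σ a₀ u₀ θ₀ N (Φ N)
        {z | ((N : ℝ) + 1) ^ (-b) < |linStat σ ρ θ u s ((Φ N).flow s z)|} ≤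
      ENNReal.ofReal (((N : ℝ) + 1) ^ (-p))

/-- `TiltedExcessAt` — STATICS PLUS ISENTROPY (reshape r2: the first half of the planner's `StaticsAt`): for some
`c > 0`, eventually in `N`, for all `s ≤ t`, `Z_N(Λ_s) ≤ exp(S(μ₀) + (N+1)·m_s + C(N+1)^{1−c})`, i.e.
`log Z_N(Λ_s) − S(μ₀) − (N+1)∫Λ_s·U(s) ≤ C N^{1−c}` (thermodynamic upper bound for the smoothly tilted canonical
partition function + Legendre identity at the Euler state + lower bound for the Gibbs entropy of the local Gibbs law
+ EXACT isentropy of the classical solution; flow-free). -/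
def TiltedExcessAt (σ : ℝ) (a₀ θ₀ : T3 → ℝ) (u₀ : T3 → V3) (ρ θ : ℝ → T3 → ℝ) (u : ℝ → T3 → V3)
    (t : ℝ) : Prop :=
  ∃ c C : ℝ, 0 < c ∧ ∃ N₀ : ℕ, ∀ N : ℕ, N₀ ≤ N → ∀ s ∈ Icc 0 t,
    tiltZ σ ρ θ u N s ≤
      ENNReal.ofReal (Real.exp (gibbsEntropy σ a₀ u₀ θ₀ N + ((N : ℝ) + 1) * tiltMean σ ρ θ u s +
        C * ((N : ℝ) + 1) ^ (1 - c)))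

/-- `EnergyMomentAt` — an EXPONENTIAL MOMENT OF THE KINETIC ENERGY under the local Gibbs laws (reshape r2: the second
half of the planner's `StaticsAt`; Gaussian velocities given the positions): `E_{μ₀} e^{κE} ≤ e^{(N+1)/κ}` for some
`κ > 0` and every `N`. -/
def EnergyMomentAt (σ : ℝ) (a₀ θ₀ : T3 → ℝ) (u₀ : T3 → V3) (Φ : Flows σ) : Prop :=
  ∃ κ : ℝ, 0 < κ ∧ ∀ N : ℕ,
    ∫⁻ z, ENNReal.ofReal (Real.exp (κ * configEnergy z)) ∂(localGibbsLaw σ a₀ u₀ θ₀ N (Φ N)) ≤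
      ENNReal.ofReal (Real.exp (((N : ℝ) + 1) / κ))

/-- `BulkTailAt` — THE OUTPUT OF THE TRANSFER: sub-Maxwellian one-particle velocity tails AT EVERY LEVEL, at each
fixed time, up to an additive polynomial slack, with polynomial probability: `∃ Θ > 0, A, a > 0` with
`P_N{ 2A e^{−K/(2Θ)} + (N+1)^{−a} < frac_K(s) } ≤ (N+1)^{−a}` for all large `N`, all `s ≤ t`, ALL `K ∈ ℝ`. -/
def BulkTailAt (σ : ℝ) (a₀ θ₀ : T3 → ℝ) (u₀ : T3 → V3) (Φ : Flows σ) (t : ℝ) : Prop :=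
  ∃ Θ A a : ℝ, 0 < Θ ∧ 0 < a ∧ ∃ N₀ : ℕ, ∀ N : ℕ, N₀ ≤ N → ∀ s ∈ Icc 0 t, ∀ K : ℝ,
    localGibbsLaw σ a₀ u₀ θ₀ N (Φ N)
        {z | 2 * A * Real.exp (-(K / (2 * Θ))) + ((N : ℝ) + 1) ^ (-a) < frac K ((Φ N).flow s z)} ≤
      ENNReal.ofReal (((N : ℝ) + 1) ^ (-a))

/-- `FarTailAt` — THE FAR-TAIL OCCUPATION INPUT (reshape r2: the time integral is a lower Lebesgue integral, equal to
the planner's Bochner form on good orbits): the EXPECTED time-integrated occupation of the levels `K ≥ K₀ log(N+2)` is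
sub-Maxwellian with a polynomial slack `(N+1)^r`: `E_N ∫₀ᵗ frac_K(s) ds ≤ t·A·(N+1)^r·e^{−K/(2Θ)}`. -/
def FarTailAt (σ : ℝ) (a₀ θ₀ : T3 → ℝ) (u₀ : T3 → V3) (Φ : Flows σ) (t : ℝ) : Prop :=
  ∃ Θ A r K₀ : ℝ, 0 < Θ ∧ ∃ N₀ : ℕ, ∀ N : ℕ, N₀ ≤ N → ∀ K : ℝ, K₀ * Real.log ((N : ℝ) + 2) ≤ K →
    ∫⁻ z, (∫⁻ s in Icc 0 t, ENNReal.ofReal (frac K ((Φ N).flow s z))) ∂(localGibbsLaw σ a₀ u₀ θ₀ N (Φ N)) ≤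
      ENNReal.ofReal (t * A * ((N : ℝ) + 1) ^ r * Real.exp (-(K / (2 * Θ))))

/-! ## Unfolding lemmas -/

/-- `frac` unfolded: the empirical mass of `{K ≤ |v|²}`. -/
theorem frac_eq {N : ℕ} (K : ℝ) (w : Cfg N) :
    frac K w = (empiricalMeasure w {y | K ≤ ‖y.2‖ ^ 2}).toReal := rfl

/-- `frac` as an average of indicators: `frac_K(w) = (N+1)⁻¹ ∑ᵢ 𝟙{K ≤ |vᵢ|²}`. -/
theorem frac_eq_avg {N : ℕ} (K : ℝ) (w : Cfg N) :
    frac K w = ((N + 1 : ℕ) : ℝ)⁻¹ * ∑ i, if K ≤ ‖(w i).2‖ ^ 2 then (1 : ℝ) else 0 := by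
  have hS : MeasurableSet {y : T3 × V3 | K ≤ ‖y.2‖ ^ 2} :=
    measurableSet_le measurable_const (measurable_snd.norm.pow_const 2)
  rw [frac, empiricalMeasure_eq, Measure.smul_apply, Measure.coe_finsetSum, Finset.sum_apply, smul_eq_mul,
    ENNReal.toReal_mul, ENNReal.toReal_inv, ENNReal.toReal_natCast,
    ENNReal.toReal_sum (fun i _ => measure_ne_top _ _)]
  congr 1
  refine Finset.sum_congr rfl fun i _ => ?_
  rw [Measure.dirac_apply' _ hS, Set.indicator_apply]
  by_cases h : K ≤ ‖(w i).2‖ ^ 2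
  · rw [if_pos (show w i ∈ {y : T3 × V3 | K ≤ ‖y.2‖ ^ 2} from h), if_pos h, Pi.one_apply, ENNReal.toReal_one]
  · rw [if_neg (show w i ∉ {y : T3 × V3 | K ≤ ‖y.2‖ ^ 2} from h), if_neg h, ENNReal.toReal_zero]

/-- `frac_K` is measurable in the configuration. -/
theorem measurable_frac {N : ℕ} (K : ℝ) : Measurable (frac (N := N) K) := by
  have h : (frac (N := N) K) = fun w => ((N + 1 : ℕ) : ℝ)⁻¹ * ∑ i, if K ≤ ‖(w i).2‖ ^ 2 then (1 : ℝ) else 0 :=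
    funext (frac_eq_avg K)
  rw [h]
  refine measurable_const.mul (Finset.measurable_sum _ fun i _ => ?_)
  exact Measurable.ite (measurableSet_le measurable_const ((measurable_pi_apply i).snd.norm.pow_const 2))
    measurable_const measurable_const

/-- `0 ≤ frac_K ≤ 1` (registered sub-goal `frac_mem_Icc` of the crux: the vocabulary file's obligation). -/
theorem frac_mem_Icc : ∀ {N : ℕ} (K : ℝ) (w : Cfg N), frac K w ∈ Icc (0 : ℝ) 1 := by
  intro N K w
  rw [frac_eq_avg]
  have hn : (0 : ℝ) < ((N + 1 : ℕ) : ℝ) := by positivity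
  refine ⟨mul_nonneg (inv_nonneg.2 hn.le) (Finset.sum_nonneg fun i _ => by split_ifs <;> norm_num), ?_⟩
  rw [inv_mul_le_iff₀ hn, mul_one]
  calc ∑ i : Fin (N + 1), (if K ≤ ‖(w i).2‖ ^ 2 then (1 : ℝ) else 0)
      ≤ ∑ _i : Fin (N + 1), (1 : ℝ) := Finset.sum_le_sum fun i _ => by split_ifs <;> norm_num
    _ = ((N + 1 : ℕ) : ℝ) := by simp

/-- `frac_K = 1` for `K ≤ 0` (every particle is above a nonpositive level). -/
theorem frac_eq_one_of_nonpos {N : ℕ} {K : ℝ} (hK : K ≤ 0) (w : Cfg N) : frac K w = 1 := by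
  rw [frac_eq_avg]
  have h : ∀ i : Fin (N + 1), (if K ≤ ‖(w i).2‖ ^ 2 then (1 : ℝ) else 0) = 1 := fun i =>
    if_pos (hK.trans (sq_nonneg _))
  simp only [h, Finset.sum_const, Finset.card_univ, Fintype.card_fin, nsmul_eq_mul, mul_one]
  have hn : ((N + 1 : ℕ) : ℝ) ≠ 0 := by positivity
  exact inv_mul_cancel₀ hn

/-- `linStat` unfolded through `integral_empiricalMeasure`: `ℓ_s(w) = (N+1)⁻¹ Φ_s(w) − m_s`. -/
theorem linStat_eq {σ : ℝ} {ρ θ : ℝ → T3 → ℝ} {u : ℝ → T3 → V3} {N : ℕ} (s : ℝ) (w : Cfg N) :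
    linStat σ ρ θ u s w = ((N + 1 : ℕ) : ℝ)⁻¹ * tiltPot σ ρ θ u s w - tiltMean σ ρ θ u s := by
  rw [linStat, tiltPot, integral_empiricalMeasure]

/-- `tiltExponent` as a completed square: `λ₀ + |u|²/(2θ) − |v − u|²/(2θ)` (for `θ ≠ 0`). -/
theorem tiltExponent_eq_sq {σ : ℝ} {ρ θ : ℝ → T3 → ℝ} {u : ℝ → T3 → V3} (s : ℝ) (y : T3 × V3)
    (hθ : θ s y.1 ≠ 0) :
    tiltExponent σ ρ θ u s y =
      lam0 σ (ρ s y.1) (θ s y.1) (u s y.1) + ‖u s y.1‖ ^ 2 / (2 * θ s y.1) -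
        ‖y.2 - u s y.1‖ ^ 2 / (2 * θ s y.1) := by
  rw [tiltExponent, @norm_sub_sq_real, real_inner_comm]
  field_simp
  ring

end Summit.AtomisticToContinuum.HydrodynamicLimit.Theorems.FibreDeficitTransfer

end
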